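import Mathlib
import Summits.ResolutionOfSingularities.ResolutionOfSingularities.Theorems.RadicialJungCleanModelsCleanProp44BirthOrderCurve
import Literature.NumberTheory.GaloisRepresentations.RamificationFiltrationHerbrandQuotientProofs
import HarnessLib

/-!
# Route `RadicialJung`, crux `CleanModels` (stmt-ResolutionOfSingularities-15917), line `Sketch` rev 35, stub 6 `stub_cleanProp44` (X44c):
# THE RESTRICTION ARGUMENT `δ ≤ ν` IN DEF-FREE FORM — an order bound along a curve from a `μ`-th power presentation

Seat decomp-res-hand-2 g20 (structural hand).  Memo 4e §2.5 «THE DESCENT: `δ*(c′) ≤ r*(c′)`» / §2.6 (b) «the restriction argument gives `δ*(c′) ≤ ν(c′)`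
VERBATIM»: if the transform `J_m` lies in `Σ_e 𝓘_{L′}^e 𝔪_{c′}^{⌈(μ−e)δ′⌉}` (i.e. `δ(c′, L′) ≥ δ′`) then on the curve `K = L′ ∩ E` through `c′` every `f ∈ J_m` has
order `≥ μδ′`; but `f_m|_K = C·φ^μ` with `C` a unit and `φ = v^{-1}(G^p − F)`, so `ord_{c′}(F − G^p) ≥ δ′`, i.e. `ν(c′) ≥ δ′`.  Hironaka's `δ` is NOT typed in the
tree (census item (iii-1)); this file types the ARGUMENT, def-free, for a commutative ring `R` (the local ring at `c′`), a curve ideal `I` (of `K`) with `R/I` a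
discrete valuation ring, and the point ideal `𝔪 ⊇ I`:

* `mem_pow_of_unit_mul_pow_mem_pow` — in a DVR: `u·x^μ ∈ 𝔪^n` (`u` a unit, `μ ≥ 1`) ⟹ `x ∈ 𝔪^{⌈n/μ⌉}` (valuation count, over the tree's
  ✓ `Literature.NumberTheory.GaloisRepresentations.mem_maximalIdeal_pow_iff_le_addVal`).
* `mem_sup_pow_of_unit_mul_pow_mem_sup_pow` — upstairs: `C·φ^μ ∈ I + 𝔪^n` ⟹ `φ ∈ I + 𝔪^{⌈n/μ⌉}` (read in `R/I` by ✓ `…BirthOrderCurve`'s dictionary).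
* `sub_pow_mem_sup_pow_of_presentation` — **`δ ≤ ν` def-free**: `f ∈ I + 𝔪^n` («`ord_K f ≥ n`», e.g. from `J ⊆ 𝓘_{L′} + 𝔪^n`, `𝓘_{L′} ⊆ I`), `f − C·φ^μ ∈ I`,
  `v·φ − (G^p − F) ∈ I` (`C` a unit) ⟹ `F − G^p ∈ I + 𝔪^{⌈n/μ⌉}`: the birth order of `F` for the curve `I` at `𝔪` is `≥ ⌈n/μ⌉`.

Honest framing: OURS, elementary; the identification of its hypotheses with the tower data of memo §2.5 (`f_m|_E = C(t_m + λ)^μ`, `K = L′ ∩ E`) is (iii-3), NOT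
done here; nothing here proves X44c, any case of `CleanModels`, or resolution of singularities in characteristic `p`.
[cite: CossartPiltant2008, Prop. 4.4 (proof, p. 11)] [cite: Matsumura1987, Thm. 11.1 (discrete valuation rings)]
-/

noncomputable section

set_option linter.dupNamespace false -- mandated namespace of this single-conjunct summit

open IsLocalRing

namespace Summit.ResolutionOfSingularities.ResolutionOfSingularities.Theorems.RadicialJung.CleanModels

/-! ## §1 In a discrete valuation ring: `u x^μ ∈ 𝔪^n ⟹ x ∈ 𝔪^{⌈n/μ⌉}` -/

section DVR

variable {S : Type*} [CommRing S] [IsDomain S] [IsDiscreteValuationRing S]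

/-- **Valuation count**: in a DVR, `u · x^μ ∈ 𝔪^n` with `u` a unit and `μ ≥ 1` forces `x ∈ 𝔪^{⌈n/μ⌉}` (`μ·v(x) ≥ n`). [cite: Matsumura1987, Thm. 11.1] -/
theorem mem_pow_of_unit_mul_pow_mem_pow {u x : S} (hu : IsUnit u) {μ n : ℕ} (hμ : 0 < μ) (h : u * x ^ μ ∈ maximalIdeal S ^ n) :
    x ∈ maximalIdeal S ^ ((n + μ - 1) / μ) := by
  rw [Literature.NumberTheory.GaloisRepresentations.mem_maximalIdeal_pow_iff_le_addVal] at h ⊢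
  have hu0 : IsDiscreteValuationRing.addVal S u = 0 := by
    obtain ⟨u', rfl⟩ := hu
    simp
  rw [IsDiscreteValuationRing.addVal_mul, hu0, zero_add, IsDiscreteValuationRing.addVal_pow] at h
  -- `n ≤ μ • v(x)`
  by_cases hx : IsDiscreteValuationRing.addVal S x = ⊤
  · rw [hx]; exact le_top
  · obtain ⟨k, hk⟩ := ENat.ne_top_iff_exists.mp hx
    rw [← hk] at h ⊢
    have h1 : (n : ℕ∞) ≤ ((μ * k : ℕ) : ℕ∞) := by
      rw [Nat.cast_mul]
      simpa [nsmul_eq_mul] using h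
    have h2 : n ≤ μ * k := by exact_mod_cast h1
    have h3 : (n + μ - 1) / μ ≤ k := by
      rw [Nat.div_le_iff_le_mul_add_pred hμ]
      have : n + μ - 1 ≤ μ * k + (μ - 1) := by omega
      linarith [Nat.mul_comm μ k]
    exact_mod_cast h3

end DVR

/-! ## §2 Upstairs: relative to a curve ideal `I` with `R/I` a DVR -/

section Curve

variable {R : Type*} [CommRing R] (I : Ideal R) [I.IsPrime] [IsDiscreteValuationRing (R ⧸ I)] (𝔪 : Ideal R)

/-- The image of `𝔪` in the DVR `R/I` is its maximal ideal as soon as `I ≤ 𝔪` and `𝔪` is maximal. [folklore] -/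
theorem map_mk_eq_maximalIdeal_of_isMaximal [𝔪.IsMaximal] (hI : I ≤ 𝔪) :
    𝔪.map (Ideal.Quotient.mk I) = maximalIdeal (R ⧸ I) := by
  have hne : 𝔪.map (Ideal.Quotient.mk I) ≠ ⊤ := by
    intro htop
    have h1 : Ideal.Quotient.mk I 1 ∈ 𝔪.map (Ideal.Quotient.mk I) := htop ▸ Submodule.mem_top
    rw [Ideal.mem_quotient_iff_mem_sup, sup_eq_left.mpr hI] at h1
    exact Ideal.IsPrime.ne_top inferInstance ((Ideal.eq_top_iff_one _).mpr h1)
  have hmax : (𝔪.map (Ideal.Quotient.mk I)).IsMaximal :=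
    (Ideal.map_eq_top_or_isMaximal_of_surjective _ Ideal.Quotient.mk_surjective inferInstance).resolve_left hne
  exact IsLocalRing.eq_maximalIdeal hmax

/-- **`C·φ^μ ∈ I + 𝔪^n` ⟹ `φ ∈ I + 𝔪^{⌈n/μ⌉}`** (`C` a unit, `μ ≥ 1`, `I ≤ 𝔪` maximal, `R/I` a DVR). [cite: Matsumura1987, Thm. 11.1] -/
theorem mem_sup_pow_of_unit_mul_pow_mem_sup_pow [𝔪.IsMaximal] (hI : I ≤ 𝔪) {C φ : R} (hC : IsUnit C) {μ n : ℕ} (hμ : 0 < μ)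
    (h : C * φ ^ μ ∈ I ⊔ 𝔪 ^ n) : φ ∈ I ⊔ 𝔪 ^ ((n + μ - 1) / μ) := by
  have h𝔪 := map_mk_eq_maximalIdeal_of_isMaximal I 𝔪 hI
  -- read in `R/I`
  have h1 : Ideal.Quotient.mk I (C * φ ^ μ) ∈ (𝔪.map (Ideal.Quotient.mk I)) ^ n := by
    rw [← Ideal.map_pow, Ideal.mem_quotient_iff_mem_sup, sup_comm]; exact h
  rw [map_mul, map_pow, h𝔪] at h1
  have h2 := mem_pow_of_unit_mul_pow_mem_pow (hC.map _) hμ h1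
  rw [← h𝔪, ← Ideal.map_pow, Ideal.mem_quotient_iff_mem_sup, sup_comm] at h2
  exact h2

/-- **THE RESTRICTION ARGUMENT `δ ≤ ν`, def-free.**  `R` a commutative ring, `I` a curve ideal with `R/I` a discrete valuation ring, `𝔪 ⊇ I` maximal; `f ∈ I + 𝔪^n`
(«`f` has order `≥ n` along the curve», e.g. `f ∈ J ⊆ 𝓘_{L′} + 𝔪^n` with `𝓘_{L′} ⊆ I`), `f − C·φ^μ ∈ I` («`f|_K = C φ^μ`», `C` a unit, `μ ≥ 1`) and
`v·φ − (G^p − F) ∈ I` («`φ|_K = v^{-1}(G^p − F)`»; `v` arbitrary).  Then `F − G^p ∈ I + 𝔪^{⌈n/μ⌉}`: the birth order of `F` relative to `I` at `𝔪` is `≥ ⌈n/μ⌉`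
(in the dictionary of ✓ `exists_sub_pow_mem_sup_pow_iff`: «`ν ≥ ⌈n/μ⌉`»). [cite: CossartPiltant2008, Prop. 4.4 (proof, p. 11)] -/
theorem sub_pow_mem_sup_pow_of_presentation [𝔪.IsMaximal] (hI : I ≤ 𝔪) (p : ℕ) {f C φ v F G : R} (hC : IsUnit C) {μ n : ℕ}
    (hμ : 0 < μ) (hf : f ∈ I ⊔ 𝔪 ^ n) (hfφ : f - C * φ ^ μ ∈ I) (hφ : v * φ - (G ^ p - F) ∈ I) :
    F - G ^ p ∈ I ⊔ 𝔪 ^ ((n + μ - 1) / μ) := by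
  -- `C φ^μ ∈ I + 𝔪^n`
  have h1 : C * φ ^ μ ∈ I ⊔ 𝔪 ^ n := by
    have h2 : C * φ ^ μ = f - (f - C * φ ^ μ) := by ring
    rw [h2]
    exact Ideal.sub_mem _ hf (Ideal.mem_sup_left hfφ)
  have h3 := mem_sup_pow_of_unit_mul_pow_mem_sup_pow I 𝔪 hI hC hμ h1
  -- `F − G^p = −(v φ) + (v φ − (G^p − F))`
  have h4 : F - G ^ p = -(v * φ) + (v * φ - (G ^ p - F)) := by ring
  rw [h4]
  refine Ideal.add_mem _ (neg_mem (Ideal.mul_mem_left _ _ h3)) (Ideal.mem_sup_left hφ)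

/-- The same read on the curve, in the shape of ✓ `exists_sub_pow_mem_sup_pow_iff`: some `F̄ − c̄^p` lies in `𝔪̄^{⌈n/μ⌉}` in `R/I`.
[cite: CossartPiltant2008, Prop. 4.4 (proof, p. 11)] -/
theorem exists_sub_pow_mem_pow_quotient_of_presentation [𝔪.IsMaximal] (hI : I ≤ 𝔪) (p : ℕ) {f C φ v F G : R} (hC : IsUnit C)
    {μ n : ℕ} (hμ : 0 < μ) (hf : f ∈ I ⊔ 𝔪 ^ n) (hfφ : f - C * φ ^ μ ∈ I) (hφ : v * φ - (G ^ p - F) ∈ I) :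
    ∃ c' : R ⧸ I, Ideal.Quotient.mk I F - c' ^ p ∈ (𝔪.map (Ideal.Quotient.mk I)) ^ ((n + μ - 1) / μ) :=
  (exists_sub_pow_mem_sup_pow_iff I 𝔪 p _ F).mp ⟨G, sub_pow_mem_sup_pow_of_presentation I 𝔪 hI p hC hμ hf hfφ hφ⟩

end Curve

end Summit.ResolutionOfSingularities.ResolutionOfSingularities.Theorems.RadicialJung.CleanModels

end
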